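import Mathlib
import HarnessLib
import Summits.Ventures.LatticeQCDFlow.Scaling.EntropyLagLaw
import Summits.Ventures.LatticeQCDFlow.Exactness.QuasiStaticSecondOrder

/-!
# EntropyE7Envelope — E7's empirical mean-work law `⟨W⟩ − ΔF ≈ k′·n_dof/n_step`, `k′ = 2τ_int·σ²`, as
# a CERTIFIED UPPER ENVELOPE with no sup-norm factor: under layers with entropy contraction `κ` and a
# sub-Gaussian equilibrium envelope, `⟨W⟩ − ΔF ≤ (2·(⟨D⟩₀ − ⟨D⟩₁) + 2s²(1 − κ)/κ)/n`

HONEST FRAMING: exact (Metropolis-corrected) sampling algorithms for lattice gauge theory;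
figures of merit are autocorrelation/cost numbers at stated couplings and volumes; no
continuum-physics claim.

Venture `LatticeQCDFlow` (cell pub-lqcd), topic `Scaling`; FANOUT row 19 (`su2-snf`, GEN-9).  OUR
WORK; nothing is cited as a fact.  Bonanno et al.'s printed law for defect switching (arXiv:2510.25704,
NAMED ONLY; row 19's "E7": `⟨W_d⟩ = k′·n_dof/n_step`) was typed by gen-4 as the exactly solvable AR(1)
model (`Scaling/AR1SwitchingLaw`: `k′ = Δ²(1+ρ)/(1−ρ) = 2τ_int·Δ²`) and bounded by gen-5's `χ²` lag law
with the factor `e^{ΔD/(2n)}`.  Here: `Scaling/EntropyLagLaw`'s packaged form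
`|⟨W⟩ − ΔF − KL_qs| ≤ KL_qs + (κ/(1−κ))·n·Λ` on the UNIT-SPAN uniform grid `c_k = k/n` (`δ = 1/n`),
for layers with ENTROPY CONTRACTION `κ ∈ (0,1)` towards their targets (Doeblin `P_k(x,·) ≥ επ_{k+1}`
gives `κ = ε`, `Scaling/EntropyLagLawDoeblin`), plus row 8's quasi-static bound
`KL_qs ≤ (⟨D⟩₀ − ⟨D⟩₁)/n` (`Exactness/QuasiStaticDissipation.qsDissipation_uniform_le`) give the
envelope in EQUILIBRIUM quantities only: the thermodynamic-integration drop
`⟨D⟩₀ − ⟨D⟩₁ = ∫₀¹ Var_c(D) dc` and the log-MGF envelope `Λ` of `D` at `λ = 2(1−κ)/(nκ)` — with a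
sub-Gaussian proxy `Λ ≤ λ²s²/2` this is `(2·drop + (2τ − 1)s²)/n`, `2τ = (2−κ)/κ = (1+ρ)/(1−ρ)` for
`ρ = 1 − κ`: E7's `2τσ²/n` shape up to `(2τ + 1)/(2τ)` when `s² ≈ σ̄² ≈ drop`.

(The grid step `1/n` is row 8's `Exactness.succ_div_sub_div`.)

* **`layerDissipation_uniform_le_E7_logMGF`** — `⟨W⟩ − ΔF ≤ 2(⟨D⟩₀ − ⟨D⟩₁)/n + (κ/(1−κ))·n·Λ`;
* **`layerDissipation_uniform_le_E7`** — sub-Gaussian envelope at `λ = 2(1−κ)/(nκ)`: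
  `⟨W⟩ − ΔF ≤ (2(⟨D⟩₀ − ⟨D⟩₁) + 2s²(1 − κ)/κ)/n`.

NOT CLAIMED: `κ`, `s` for any lattice sweep; that the envelope is attained; numbers.
-/

namespace Summit.Ventures.LatticeQCDFlow.Scaling

open Finset
open Literature.Probability.MarkovChains (IsRowStochastic stepLaw)
open Summit.Ventures.LatticeQCDFlow.Exactness
open Summit.Ventures.LatticeQCDFlow.Theory2

variable {X : Type*} [Fintype X]

/-- **E7 AS A CERTIFIED ENVELOPE (log-MGF form).**  Unit-span uniform grid `c_k = k/n` (`n ≠ 0`),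
row-stochastic layers with entropy contraction `κ ∈ (0,1)` towards their targets, and an envelope `Λ`
of the equilibrium log-MGFs `log Σ π_j e^{±λ(D − ⟨D⟩_j)}` at `λ = 2(1−κ)/(nκ)`, `j < n`.  Then
`⟨W⟩ − ΔF ≤ 2(⟨D⟩₀ − ⟨D⟩₁)/n + (κ/(1−κ))·n·Λ`. [ours] -/
theorem layerDissipation_uniform_le_E7_logMGF [Nonempty X] (S₀ D : X → ℝ) (P : ℕ → X → X → ℝ)
    (hP : ∀ k, IsRowStochastic (P k)) {n : ℕ} (hn : n ≠ 0) {κ : ℝ} (hκ0 : 0 < κ) (hκ1 : κ < 1)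
    (hK : ∀ k (μ : X → ℝ), (∀ x, 0 ≤ μ x) → ∑ x, μ x = 1 →
      klFin (stepLaw (P k) μ) (gibbsLaw (linAction S₀ D (((k + 1 : ℕ) : ℝ) / n)))
        ≤ (1 - κ) * klFin μ (gibbsLaw (linAction S₀ D (((k + 1 : ℕ) : ℝ) / n)))) {Λ : ℝ}
    (hΛp : ∀ j, j < n → Real.log (∑ y, gibbsLaw (linAction S₀ D ((j : ℝ) / n)) y
        * Real.exp ((2 * (1 / n) * (1 - κ) / κ) * (D y - meanD S₀ D ((j : ℝ) / n)))) ≤ Λ)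
    (hΛm : ∀ j, j < n → Real.log (∑ y, gibbsLaw (linAction S₀ D ((j : ℝ) / n)) y
        * Real.exp (-(2 * (1 / n) * (1 - κ) / κ) * (D y - meanD S₀ D ((j : ℝ) / n)))) ≤ Λ) :
    layerDissipation S₀ D (fun k => (k : ℝ) / n) P n
      ≤ 2 * (meanD S₀ D 0 - meanD S₀ D 1) / n + κ / (1 - κ) * n * Λ := by
  have hn' : (0 : ℝ) < n := by exact_mod_cast Nat.pos_of_ne_zero hn
  have hδ : (0 : ℝ) < 1 / n := by positivity
  have hc : ∀ k : ℕ, ((fun k : ℕ => (k : ℝ) / n) (k + 1)) - (fun k : ℕ => (k : ℝ) / n) k = 1 / n :=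
    fun k => by simp only; exact_mod_cast succ_div_sub_div hn k
  have key := abs_layerDissipation_sub_qs_le_entropy S₀ D (fun k => (k : ℝ) / n) P hP hδ hc hκ0 hκ1
    (by intro k μ hμ hμ1; exact_mod_cast hK k μ hμ hμ1) n
    (by intro j hj; exact_mod_cast hΛp j hj) (by intro j hj; exact_mod_cast hΛm j hj)
  have hqs := qsDissipation_uniform_le S₀ D hn
  have h1 := (abs_le.1 key).2
  have h2 : layerDissipation S₀ D (fun k => (k : ℝ) / n) P n
      ≤ 2 * ((meanD S₀ D 0 - meanD S₀ D 1) / n) + κ / (1 - κ) * n * Λ := by linarith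
  calc layerDissipation S₀ D (fun k => (k : ℝ) / n) P n
      ≤ 2 * ((meanD S₀ D 0 - meanD S₀ D 1) / n) + κ / (1 - κ) * n * Λ := h2
    _ = 2 * (meanD S₀ D 0 - meanD S₀ D 1) / n + κ / (1 - κ) * n * Λ := by ring

/-- **E7 AS A CERTIFIED ENVELOPE (sub-Gaussian form)**: with the envelope `Λ = λ²s²/2` at
`λ = 2(1−κ)/(nκ)`: `⟨W⟩ − ΔF ≤ (2(⟨D⟩₀ − ⟨D⟩₁) + 2s²(1 − κ)/κ)/n` — the drop plus `(2τ − 1)s²`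
over `n`, `2τ = (2 − κ)/κ`. [ours] -/
theorem layerDissipation_uniform_le_E7 [Nonempty X] (S₀ D : X → ℝ) (P : ℕ → X → X → ℝ)
    (hP : ∀ k, IsRowStochastic (P k)) {n : ℕ} (hn : n ≠ 0) {κ : ℝ} (hκ0 : 0 < κ) (hκ1 : κ < 1)
    (hK : ∀ k (μ : X → ℝ), (∀ x, 0 ≤ μ x) → ∑ x, μ x = 1 →
      klFin (stepLaw (P k) μ) (gibbsLaw (linAction S₀ D (((k + 1 : ℕ) : ℝ) / n)))
        ≤ (1 - κ) * klFin μ (gibbsLaw (linAction S₀ D (((k + 1 : ℕ) : ℝ) / n)))) {s : ℝ}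
    (hΛp : ∀ j, j < n → Real.log (∑ y, gibbsLaw (linAction S₀ D ((j : ℝ) / n)) y
        * Real.exp ((2 * (1 / n) * (1 - κ) / κ) * (D y - meanD S₀ D ((j : ℝ) / n))))
          ≤ (2 * (1 / n) * (1 - κ) / κ) ^ 2 * s ^ 2 / 2)
    (hΛm : ∀ j, j < n → Real.log (∑ y, gibbsLaw (linAction S₀ D ((j : ℝ) / n)) y
        * Real.exp (-(2 * (1 / n) * (1 - κ) / κ) * (D y - meanD S₀ D ((j : ℝ) / n))))
          ≤ (2 * (1 / n) * (1 - κ) / κ) ^ 2 * s ^ 2 / 2) :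
    layerDissipation S₀ D (fun k => (k : ℝ) / n) P n
      ≤ (2 * (meanD S₀ D 0 - meanD S₀ D 1) + 2 * s ^ 2 * (1 - κ) / κ) / n := by
  have hn' : (0 : ℝ) < n := by exact_mod_cast Nat.pos_of_ne_zero hn
  have key := layerDissipation_uniform_le_E7_logMGF S₀ D P hP hn hκ0 hκ1 hK hΛp hΛm
  have hκne : 1 - κ ≠ 0 := (sub_pos.2 hκ1).ne'
  have halg : κ / (1 - κ) * n * ((2 * (1 / (n : ℝ)) * (1 - κ) / κ) ^ 2 * s ^ 2 / 2)
      = (2 * s ^ 2 * (1 - κ) / κ) / n := by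
    field_simp
  rw [halg] at key
  calc layerDissipation S₀ D (fun k => (k : ℝ) / n) P n
      ≤ 2 * (meanD S₀ D 0 - meanD S₀ D 1) / n + (2 * s ^ 2 * (1 - κ) / κ) / n := key
    _ = (2 * (meanD S₀ D 0 - meanD S₀ D 1) + 2 * s ^ 2 * (1 - κ) / κ) / n := by ring

end Summit.Ventures.LatticeQCDFlow.Scaling
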